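import Summits.MatrixMultiplication.OmegaCensus.STPP211Z2pow6DirectReflect
import Summits.MatrixMultiplication.OmegaCensus.STPP211Z2pow6CoverEngine

/-!
# (2,1,1)¹⁰ ⊄ (ℤ/2)⁶ — part S2b: symmetry TRANSPORT for the direct engine (from a class's root table to «no family over the class»)

Cell `pub-omega` (unit `pub-omega-stpp-1-g37`), topic `Summits/MatrixMultiplication/OmegaCensus`.
HONEST FRAMING (verbatim): lottery ticket; floor = certified bounds/negative ranges. Census STRUCTURE bookkeeping (B5, `T1((ℤ/2)⁶)`, Pb237);
nothing here is a bound on `ω`.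

The direct engine decides a hard class `C'` (ten `c`-codes, `C'[0] = 0`) only at a few ROOTS `A₀ = {0, dec d}`, `d` running over
representatives of the orbits of the linear stabilizer `Stab_GL(C')` on the codes outside `C'` (HOME `pub-omega-stpp-1-g36/S3-RECIPE.md`
§S2). This file turns such root decisions into the class theorem, generically in the class data:
* `NFState.shiftA` — a common translation of all `A`-sets keeps a normal-form family (so WLOG `0 ∈ A₀`); the partner of `0` in `A₀` is a
  code `x ∉ C'` (pairwise law);
* `symRowOK C' (x, L, s, r)` (Bool, kernel-checkable per row): `lin L` is a checked linear bijection with `L x = r` and `L C'[i] = C'[s i]`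
  for a permutation `s` of the ten blocks fixing block `0`; `transport_root`: a normal-form family over `C'` with `A₀ = {0, dec x}` yields
  one with `A₀ = {0, dec r}` (map by `lin L`, re-index by `s⁻¹`);
* `classTableOK C' reps T` (Bool): `C'` has ten codes `< 64` with `C'[0] = 0`, every row of `T` passes `symRowOK` with target in `reps`,
  and every code `< 64` is in `C'` or is the `x` of a row; **`noNF_of_classTable`**: with `rootD C' r = true` for all `r ∈ reps`, there is
  NO normal-form `(2,1,1)¹⁰` family over `C'`;
* `relabelOK D t π C'` (Bool) and `noNF_of_relabel`: «no family over `C'`» transfers to any code list `D` with `D[π i] + t = C'[i]`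
  (the class representative of `reps29` versus its translated, re-ordered form `C'`).

References: H. Cohn, R. Kleinberg, B. Szegedy, C. Umans, FOCS 2005 (arXiv:math/0511460), Def. 5.1.
-/

namespace Summit.MatrixMultiplication.OmegaCensus

namespace T1Z2p6

open Finset Literature.Computability.AlgebraicComplexity T1CosetEng T1Coset

/-! ## A common shift of the `A`-sets -/

/-- MOVE 4: a common translation of all `A`-sets keeps a normal-form family. -/
theorem NFState.shiftA {A : Fin 10 → Finset G6} {c : Fin 10 → G6} (h : NFState A c) (α : G6) :
    NFState (fun i => (A i).image (· + α)) c := by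
  have h1 := (h.stpp.translate fun _ => α).shiftBC α α
  have hB : (fun _ : Fin 10 => (({0} : Finset G6).image (· + α)).image (· + α)) = fun _ => ({0} : Finset G6) := by
    funext i; rw [image_singleton, image_singleton, zero_add, add_self6]
  have hC : (fun i : Fin 10 => (({c i} : Finset G6).image (· + α)).image (· + α)) = fun i => ({c i} : Finset G6) := by
    funext i; rw [image_singleton, image_singleton, add_assoc, add_self6, add_zero]
  rw [hB, hC] at h1
  exact ⟨h1, fun i => by rw [card_image_of_injective _ (add_left_injective α)]; exact h.card_two i⟩

/-! ## Block permutations from checked index lists -/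

/-- A list of ten indices that sorts to `0, …, 9` (so it is a permutation of the blocks). -/
def idxPermOK (s : List ℕ) : Bool := beqL (s.insertionSort fun a b => Nat.ble a b = true) (List.range 10)

/-- Reading `idxPermOK`: the list is a permutation of `List.range 10`. -/
theorem perm_of_idxPermOK {s : List ℕ} (h : idxPermOK s = true) : s.Perm (List.range 10) := by
  have e := eq_of_beqL h
  rw [← e]
  exact (List.perm_insertionSort _ _).symm

/-- Entries of a checked index list are `< 10`. -/
theorem getD_lt_of_idxPermOK {s : List ℕ} (h : idxPermOK s = true) (i : Fin 10) : s.getD i.val 0 < 10 := by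
  have hp := perm_of_idxPermOK h
  have hlen : s.length = 10 := by rw [hp.length_eq, List.length_range]
  have hm : s.getD i.val 0 ∈ s := by
    rw [List.getD_eq_getElem _ _ (by rw [hlen]; exact i.isLt)]; exact List.getElem_mem _
  exact List.mem_range.1 (hp.subset hm)

/-- The block map of a checked index list. -/
def idxFun (s : List ℕ) (h : idxPermOK s = true) (i : Fin 10) : Fin 10 := ⟨s.getD i.val 0, getD_lt_of_idxPermOK h i⟩

/-- The block map of a checked index list is a bijection. -/
theorem idxFun_bijective {s : List ℕ} (h : idxPermOK s = true) : Function.Bijective (idxFun s h) := by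
  have hp := perm_of_idxPermOK h
  have hlen : s.length = 10 := by rw [hp.length_eq, List.length_range]
  have hnd : s.Nodup := hp.nodup_iff.2 (List.nodup_range)
  refine Finite.injective_iff_bijective.1 fun i j hij => ?_
  have e : s.getD i.val 0 = s.getD j.val 0 := by
    have := congrArg Fin.val hij; exact this
  rw [List.getD_eq_getElem _ _ (by rw [hlen]; exact i.isLt), List.getD_eq_getElem _ _ (by rw [hlen]; exact j.isLt)] at e
  exact Fin.ext ((hnd.getElem_inj_iff).1 e)

/-- The block permutation of a checked index list. -/
noncomputable def idxEquiv (s : List ℕ) (h : idxPermOK s = true) : Fin 10 ≃ Fin 10 := Equiv.ofBijective _ (idxFun_bijective h)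

/-! ## One symmetry row -/

/-- The check of a symmetry row `(x, L, s, r)` of the class `C`: `lin L` is a checked linear bijection, `L x = r`, `s` a permutation of
the blocks with `s 0 = 0`, and `L C[i] = C[s i]` for all ten blocks. -/
def symRowOK (C : List ℕ) (row : ℕ × List ℕ × List ℕ × ℕ) : Bool :=
  linOK row.2.1 && Nat.beq (linC row.2.1 row.1) row.2.2.2 && idxPermOK row.2.2.1 && Nat.beq (row.2.2.1.getD 0 0) 0 &&
    (List.range 10).all fun i => Nat.beq (linC row.2.1 (C.getD i 0)) (C.getD (row.2.2.1.getD i 0) 0)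

/-- **Transport of the root along a symmetry row:** a normal-form family over `C` with `A₀ = {0, dec x}` yields one with
`A₀ = {0, dec r}`. -/
theorem transport_root {C : List ℕ} (hC : ∀ c ∈ C, c < 64) (hlen : C.length = 10) {row : ℕ × List ℕ × List ℕ × ℕ}
    (hrow : symRowOK C row = true) (hx : row.1 < 64) {A : Fin 10 → Finset G6}
    (h : NFState A (fun i => dec (C.getD i.val 0))) (hA0 : A 0 = {0, dec row.1}) :
    ∃ A' : Fin 10 → Finset G6, NFState A' (fun i => dec (C.getD i.val 0)) ∧ A' 0 = {0, dec row.2.2.2} := by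
  unfold symRowOK at hrow
  simp only [Bool.and_eq_true, List.all_eq_true] at hrow
  obtain ⟨⟨⟨⟨hL, hLx⟩, hs⟩, hs0⟩, hLC⟩ := hrow
  have hLx' := Nat.eq_of_beq_eq_true hLx
  have hs0' := Nat.eq_of_beq_eq_true hs0
  set σ := idxEquiv row.2.2.1 hs with hσ
  have hσval : ∀ i : Fin 10, (σ i).val = row.2.2.1.getD i.val 0 := fun i => rfl
  have hσ0 : σ 0 = 0 := Fin.ext (by rw [hσval]; exact hs0')
  -- map by `lin L`
  have h₂ := h.map (lin row.2.1 hL) (lin_injective _ hL)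
  have hc : (fun i : Fin 10 => lin row.2.1 hL (dec (C.getD i.val 0))) = fun i => dec (C.getD (σ i).val 0) := by
    funext i
    have hi : C.getD i.val 0 < 64 := by
      rw [List.getD_eq_getElem _ _ (by rw [hlen]; exact i.isLt)]; exact hC _ (List.getElem_mem _)
    have e := Nat.eq_of_beq_eq_true (hLC i.val (List.mem_range.2 i.isLt))
    show linFun row.2.1 (dec (C.getD i.val 0)) = _
    unfold linFun
    rw [enc_dec _ hi, e, hσval]
  rw [hc] at h₂
  -- re-index by `σ⁻¹`
  have h₃ := h₂.reindex σ.symm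
  simp only [Equiv.apply_symm_apply] at h₃
  refine ⟨fun j => (A (σ.symm j)).image (lin row.2.1 hL), h₃, ?_⟩
  show (A (σ.symm 0)).image (lin row.2.1 hL) = _
  have : σ.symm 0 = 0 := by have e := Equiv.symm_apply_apply σ 0; rwa [hσ0] at e
  rw [this, hA0, image_insert, image_singleton, map_zero]
  congr 1
  show {linFun row.2.1 (dec row.1)} = ({dec row.2.2.2} : Finset G6)
  unfold linFun
  rw [enc_dec _ hx, hLx']

/-! ## A class from its table -/

/-- The check of a class table: `C` has ten codes `< 64` with `C[0] = 0`; every row passes `symRowOK` with `x < 64` and target in `reps`;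
every code `< 64` lies in `C` or is the `x` of some row. -/
def classTableOK (C : List ℕ) (reps : List ℕ) (T : List (ℕ × List ℕ × List ℕ × ℕ)) : Bool :=
  Nat.beq C.length 10 && C.all (fun c => Nat.blt c 64) && Nat.beq (C.getD 0 0) 0 &&
    T.all (fun row => symRowOK C row && reps.elem row.2.2.2 && Nat.blt row.1 64) &&
    (List.range 64).all fun x => C.elem x || T.any fun row => Nat.beq row.1 x

/-- **A CLASS FROM ITS TABLE:** if the class table checks and the direct engine refutes every representative root, there is NO
normal-form `(2,1,1)¹⁰` family over `C`. [cite: CohnKleinbergSzegedyUmans2005, Def. 5.1] -/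
theorem noNF_of_classTable {C : List ℕ} {reps : List ℕ} {T : List (ℕ × List ℕ × List ℕ × ℕ)} (hT : classTableOK C reps T = true)
    (hreps : ∀ r ∈ reps, rootD C r = true) :
    ¬ ∃ A : Fin 10 → Finset G6, IsSTPP A (fun _ => ({0} : Finset G6)) (fun i => {dec (C.getD i.val 0)}) ∧ ∀ i, (A i).card = 2 := by
  unfold classTableOK at hT
  simp only [Bool.and_eq_true, List.all_eq_true] at hT
  obtain ⟨⟨⟨⟨hlen, hlt⟩, hC0⟩, hrows⟩, hcov⟩ := hT
  have hlen' := Nat.eq_of_beq_eq_true hlen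
  have hlt' : ∀ c ∈ C, c < 64 := fun c hc => by have := hlt c hc; simpa using this
  have hC0' := Nat.eq_of_beq_eq_true hC0
  rintro ⟨A, hst, hcard⟩
  have h : NFState A (fun i => dec (C.getD i.val 0)) := ⟨hst, hcard⟩
  -- normalise `0 ∈ A 0`
  obtain ⟨a, a', hne, hA0⟩ := card_eq_two.1 (hcard 0)
  have h₁ := h.shiftA a
  have hA0' : (A 0).image (· + a) = {0, a' + a} := by
    rw [hA0, image_insert, image_singleton, add_self6]
  set x := enc (a' + a) with hxdef
  have hx64 : x < 64 := enc_lt _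
  have hxne : x ≠ 0 := fun e => by
    have h0 : a' + a = 0 := enc_injective (by rw [← hxdef, e, enc_zero])
    have : a' = a := by
      have h2 := congrArg (· + a) h0; simp only [add_assoc, add_self6, add_zero, zero_add] at h2; exact h2
    exact hne this.symm
  -- `x ∉ C`: the pairwise law
  have hxC : x ∉ C := fun hxm => by
    obtain ⟨j, hj, hjx⟩ := List.getElem_of_mem hxm
    have hj10 : j < 10 := by rw [← hlen']; exact hj
    have hp := nf_pairwise h₁.stpp (i := 0) (l := 0) (x := a' + a) (y := 0)
      (by show a' + a ∈ (A 0).image (· + a); rw [hA0']; exact mem_insert_of_mem (mem_singleton_self _))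
      (by show (0 : G6) ∈ (A 0).image (· + a); rw [hA0']; exact mem_insert_self _ _)
      (fun e => hxne (by have e1 : a' + a = 0 := congrArg Prod.fst e; rw [hxdef, e1, enc_zero])) ⟨j, hj10⟩
    apply hp
    show a' + a - 0 = dec (C.getD j 0) - dec (C.getD 0 0)
    rw [hC0', List.getD_eq_getElem _ _ hj, hjx, hxdef, dec_enc, show (dec 0 : G6) = 0 from by decide]
  -- the row of `x`
  have hcx := hcov x (List.mem_range.2 hx64)
  rw [Bool.or_eq_true] at hcx
  rcases hcx with hcx | hcx
  · exact hxC (by simpa using hcx)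
  obtain ⟨row, hrow, hrx⟩ := List.any_eq_true.1 hcx
  have hrx' : row.1 = x := Nat.eq_of_beq_eq_true hrx
  obtain ⟨⟨hsym, hrep⟩, _⟩ := hrows row hrow
  have hrep' : row.2.2.2 ∈ reps := by simpa using hrep
  have hA0x : (A 0).image (· + a) = {0, dec row.1} := by rw [hA0', hrx', hxdef, dec_enc]
  obtain ⟨A', h', hA'0⟩ := transport_root hlt' hlen' hsym (by rw [hrx']; exact hx64) h₁ hA0x
  -- the direct engine at the representative root
  have hr64 : row.2.2.2 < 64 := by
    unfold symRowOK at hsym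
    simp only [Bool.and_eq_true] at hsym
    rw [← Nat.eq_of_beq_eq_true hsym.1.1.1.2]
    exact linC_lt (linOK_spec hsym.1.1.1.1).1 _
  exact noNF_of_rootD hlen' hlt' (by norm_num) (by norm_num) hr64 (hreps _ hrep') ⟨A', h'.stpp, h'.card_two, hA'0⟩

/-! ## Relabelling: from the translated, re-ordered class back to any code list -/

/-- The check `D[π i] + t = C[i]` for all ten blocks, `π` a permutation of the blocks, ten codes `< 64` in `D`. -/
def relabelOK (D : List ℕ) (t : ℕ) (π : List ℕ) (C : List ℕ) : Bool :=
  Nat.beq D.length 10 && D.all (fun c => Nat.blt c 64) && Nat.blt t 64 && idxPermOK π &&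
    (List.range 10).all fun i => Nat.beq (Nat.xor (D.getD (π.getD i 0) 0) t) (C.getD i 0)

/-- **Relabelling:** «no normal-form family over `C`» gives «no normal-form family over `D`» when `D[π i] + t = C[i]` (a `C`-shift by
`dec t` and a re-indexing by `π`). [cite: CohnKleinbergSzegedyUmans2005, Def. 5.1] -/
theorem noNF_of_relabel {D : List ℕ} {t : ℕ} {π : List ℕ} {C : List ℕ} (hR : relabelOK D t π C = true)
    (hC : ¬ ∃ A : Fin 10 → Finset G6, IsSTPP A (fun _ => ({0} : Finset G6)) (fun i => {dec (C.getD i.val 0)}) ∧ ∀ i, (A i).card = 2) :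
    ¬ ∃ A : Fin 10 → Finset G6, IsSTPP A (fun _ => ({0} : Finset G6)) (fun i => {dec (D.getD i.val 0)}) ∧ ∀ i, (A i).card = 2 := by
  unfold relabelOK at hR
  simp only [Bool.and_eq_true, List.all_eq_true] at hR
  obtain ⟨⟨⟨⟨hlen, hlt⟩, ht⟩, hπ⟩, hrel⟩ := hR
  have hlen' := Nat.eq_of_beq_eq_true hlen
  have ht' : t < 64 := by simpa using ht
  rintro ⟨A, hst, hcard⟩
  have h : NFState A (fun i => dec (D.getD i.val 0)) := ⟨hst, hcard⟩
  have h₁ := h.shiftC (dec t)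
  set σ := idxEquiv π hπ
  have h₂ := h₁.reindex σ
  apply hC
  refine ⟨fun i => A (σ i), ?_, h₂.card_two⟩
  have hc : (fun i : Fin 10 => dec (D.getD (σ i).val 0) + dec t) = fun i => dec (C.getD i.val 0) := by
    funext i
    have e := Nat.eq_of_beq_eq_true (hrel i.val (List.mem_range.2 i.isLt))
    have hD : D.getD (π.getD i.val 0) 0 < 64 := by
      have : D.getD (π.getD i.val 0) 0 ∈ D := by
        rw [List.getD_eq_getElem _ _ (by rw [hlen']; exact getD_lt_of_idxPermOK hπ i)]; exact List.getElem_mem _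
      simpa using hlt _ this
    show dec (D.getD (π.getD i.val 0) 0) + dec t = _
    rw [← dec_xor _ hD _ ht', e]
  rw [hc] at h₂
  exact h₂.stpp

end T1Z2p6

end Summit.MatrixMultiplication.OmegaCensus
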